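/-
Copyright (c) 2026. All rights reserved.
Released under Apache 2.0 license as described in the file LICENSE.
Authors: abc-iut cell — author of record abc-iut-L3-d5 (G10 rung 2); filer-of-record abc-iut-w4-d064 (orphan rescue, imports/module name only).
-/
import Literature.AnabelianGeometry.SemiGraphs.UniversalCoveringOverTempered
import Literature.AnabelianGeometry.SemiGraphs.UniversalCoveringOverHomogeneous
import Literature.AnabelianGeometry.SemiGraphs.UniversalCoveringOverOneComponent
import Literature.AnabelianGeometry.SemiGraphs.TemperedCoveringsRestrict
import Literature.AnabelianGeometry.SemiGraphs.TemperoidsGaloisObjectsProofs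
import Literature.AnabelianGeometry.SemiGraphs.MorphismsOver
import Literature.AnabelianGeometry.SemiGraphs.SubdivisionLemmas
import Literature.AnabelianGeometry.SemiGraphs.CoveringComponentSupport
import HarnessLib


/-!
# `𝒢_{∞,F}` is a Galois object of `B^temp(𝒢)` ([SemiAnbd] §3 p. 38)

[SemiAnbd] p. 38: for a finite étale Galois covering `𝒢_i → 𝒢`, the covering `𝒢_{∞,i} → 𝒢`
("determined by the universal graph-covering of `𝔾_i`") is Galois.  In the presentation of
`TemperedCoverings.lean` / `Temperoids.lean` (Def. 3.1 (iv): `T` Galois iff `T` is connected and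
for any two arrows `ψ₁, ψ₂ : S → T` from a connected `S` there is `α ∈ Aut T` with
`ψ₁ = α ∘ ψ₂`): if `Aut(𝒢_{∞,F})` acts transitively on the vertex fibres of
`𝒢_{∞,F} = univCoverOver F [V₀]` (t9's `exists_aut_apply_eq'`, true when the endomorphisms of `F`
act transitively on its fibres, e.g. `F` Galois) and `𝒢_{∞,F}` is tempered, then `𝒢_{∞,F}` is a
Galois object of `B^temp(𝒢)`.  Ingredients: `𝒢_{∞,F}` has one component
(`univCoverOver_sameComponent`) hence is connected (`isConnectedObj_of_sameComponent`); a connected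
test object `S` has a point and one component (`sameComponent_of_isConnectedObj`), and morphisms
out of it are determined by one value (`CovHom.ext_of_sameComponent`).
-/

namespace Literature.AnabelianGeometry.SemiGraphs

namespace ProfiniteSemiGraph

open CategoryTheory CategoryTheory.Limits
open Literature.AlgebraicGeometry.Frobenioids (IsConnectedObj IsNonemptyObj)

universe u

variable {𝒢 : ProfiniteSemiGraph.{u}}

/-- In a connected semi-graph with a vertex, every edge has a branch abutting to a vertex; hence
every object of `B^temp(𝒢)` with a point has a point in a VERTEX fibre, in the same component.
[cite: MochizukiSemiAnbd2006, §3 p.36] -/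
theorem exists_vertex_point_sameComponent (h𝒢c : 𝒢.graph.IsConnected) (hV : 𝒢.HasVertex)
    (S : CovObj 𝒢) (p : S.Point) :
    ∃ (v : 𝒢.graph.Vertex) (s : (S.SV v).obj.V), S.SameComponent p (Sum.inl ⟨v, s⟩) := by
  rcases p with ⟨v, s⟩ | ⟨e, y⟩
  · exact ⟨v, s, Relation.EqvGen.refl _⟩
  · obtain ⟨b, hb, hsome⟩ := SemiGraph.exists_abuts_of_isConnected h𝒢c hV.some e
    obtain ⟨v, hv⟩ := Option.isSome_iff_exists.mp hsome
    subst hb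
    exact ⟨v, (S.glue b v hv).hom.hom.hom y, Relation.EqvGen.rel _ _ (CovObj.Adj.glue b v hv y)⟩

/-- **In a connected `𝒢`, every connected component of a covering has a point over every vertex.**
[cite: MochizukiSemiAnbd2006, Def 3.5(ii) p.37] -/
theorem CovObj.exists_point_over_of_isConnected (h𝒢c : 𝒢.graph.IsConnected) (S : CovObj 𝒢)
    (p : S.Point) (w : 𝒢.graph.Vertex) :
    ∃ s : (S.SV w).obj.V, S.SameComponent p (Sum.inl ⟨w, s⟩) := by
  -- the node under `p` carries a point of the component of `p` (abc-iut-L3-t9's `HasPtOver`)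
  obtain ⟨n, hn⟩ : ∃ n : 𝒢.graph.Node, S.HasPtOver p n := by
    rcases p with ⟨v, s⟩ | ⟨e, y⟩
    · exact ⟨Sum.inl v, s, Relation.EqvGen.refl _⟩
    · exact ⟨Sum.inr (Sum.inl e), y, Relation.EqvGen.refl _⟩
  -- walk to `w` in the (connected) subdivision
  obtain ⟨walk⟩ := h𝒢c.connected.preconnected n (Sum.inl w)
  exact S.hasPtOver_of_walk p walk hn

/-- **`𝒢_{∞,F}` is connected** in `B^temp(𝒢)` (§0 sense), for any covering `F` and base
vertex-orbit `V₀`, as soon as it is tempered. [cite: MochizukiSemiAnbd2006, Prop 3.6 p.38] -/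
theorem isConnectedObj_univCoverOverT (F : CovObj 𝒢) (V₀ : F.OVertex) (h𝒢 : 𝒢.IsCountable)
    (hT : (F.univCoverOver (Sum.inl V₀) h𝒢).IsTempered) :
    IsConnectedObj (⟨F.univCoverOver (Sum.inl V₀) h𝒢, hT⟩ : BTempCat 𝒢) := by
  obtain ⟨x, hx⟩ := CovObj.OVertex.exists_rep F V₀
  exact isConnectedObj_of_sameComponent _
    (Sum.inl ⟨_, (⟨⟨V₀, rfl⟩, ⟨⟨x, hx⟩, 𝟙 _⟩⟩ : F.FibV (Sum.inl V₀) (CovObj.OVertex.base F V₀))⟩)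
    fun q => F.univCoverOver_sameComponent _ h𝒢 _ q

/-- **`𝒢_{∞,F}` is a Galois object of `B^temp(𝒢)`** ([SemiAnbd] p. 38, "`𝒢_{∞,i} → 𝒢` … Galois")
whenever it is tempered and its automorphism group acts transitively on its vertex fibres (the
latter holds when the endomorphisms of `F` act transitively on the fibres of `F` —
`UniversalCoveringOverHomogeneous`), for `𝒢` connected with a vertex.
[cite: MochizukiSemiAnbd2006, Prop 3.6 p.38] -/
theorem isGaloisObj_univCoverOverT (h𝒢c : 𝒢.graph.IsConnected) (hV : 𝒢.HasVertex) (F : CovObj 𝒢)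
    (V₀ : F.OVertex) (h𝒢 : 𝒢.IsCountable) (hT : (F.univCoverOver (Sum.inl V₀) h𝒢).IsTempered)
    (htrans : ∀ {v : 𝒢.graph.Vertex} (t t' : F.FibV (Sum.inl V₀) v),
      ∃ η : F.univCoverOver (Sum.inl V₀) h𝒢 ≅ F.univCoverOver (Sum.inl V₀) h𝒢,
        (η.hom.fV v).hom.hom t = t') :
    IsGaloisObj (⟨F.univCoverOver (Sum.inl V₀) h𝒢, hT⟩ : BTempCat 𝒢) := by
  refine ⟨isConnectedObj_univCoverOverT F V₀ h𝒢 hT, fun S hS ψ₁ ψ₂ => ?_⟩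
  -- a vertex point `(v, s)` of the connected test object `S`, which has one component
  obtain ⟨p⟩ := nonempty_point_of_isConnectedObj S hS
  obtain ⟨v, s, -⟩ := exists_vertex_point_sameComponent h𝒢c hV S.obj p
  have hconn : ∀ q, S.obj.SameComponent (Sum.inl ⟨v, s⟩) q :=
    fun q => sameComponent_of_isConnectedObj S hS _ q
  -- an automorphism moving `ψ₂ (v, s)` to `ψ₁ (v, s)`
  obtain ⟨η, hη⟩ := htrans ((ψ₂.hom.fV v).hom.hom s) ((ψ₁.hom.fV v).hom.hom s)
  refine ⟨ObjectProperty.isoMk _ η, ?_⟩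
  apply ObjectProperty.hom_ext
  change ψ₁.hom = ψ₂.hom ≫ η.hom
  refine CovHom.ext_of_sameComponent _ _ (Sum.inl ⟨v, s⟩) hconn ?_
  change (Sum.inl ⟨v, (ψ₁.hom.fV v).hom.hom s⟩ : (F.univCoverOver (Sum.inl V₀) h𝒢).Point) =
    Sum.inl ⟨v, (η.hom.fV v).hom.hom ((ψ₂.hom.fV v).hom.hom s)⟩
  rw [hη]

/-- The same with temperedness supplied by Galois-countability (`𝒢_{∞,F}` is tempered for every
finite `F`, `UniversalCoveringOverTempered`). [cite: MochizukiSemiAnbd2006, Prop 3.6 p.38] -/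
theorem isGaloisObj_univCoverOverT_of_isGaloisCountable (h𝒢c : 𝒢.graph.IsConnected)
    (hV : 𝒢.HasVertex) (hgc : 𝒢.IsGaloisCountable) (F : CovObj 𝒢) (hF : F.IsFinite)
    (V₀ : F.OVertex) (h𝒢 : 𝒢.IsCountable)
    (htrans : ∀ {v : 𝒢.graph.Vertex} (t t' : F.FibV (Sum.inl V₀) v),
      ∃ η : F.univCoverOver (Sum.inl V₀) h𝒢 ≅ F.univCoverOver (Sum.inl V₀) h𝒢,
        (η.hom.fV v).hom.hom t = t') :
    IsGaloisObj (⟨F.univCoverOver (Sum.inl V₀) h𝒢,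
      F.univCoverOver_isTempered_of_isGaloisCountable _ h𝒢 hgc hF⟩ : BTempCat 𝒢) :=
  isGaloisObj_univCoverOverT h𝒢c hV F V₀ h𝒢 _ htrans

end ProfiniteSemiGraph

end Literature.AnabelianGeometry.SemiGraphs
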